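import Literature.AlgebraicGeometry.Resolution.LinearSectionsCharts
import HarnessLib

/-!
# Forms of one degree generating an ideal sheaf chart by chart (Serre generators)

[OURS · L1 W4.5(b)] Helper for the crux `EquisingularLift` (stmt-ResolutionOfSingularities-15660), line `Sketch`,
skeleton v10 (LINEAR-CENTRE), downstairs half of `stub_EL_of_blowupModel`, Step 1 («Serre / Hartshorne II.5.14,
elementary form»). Not a statement of any manuscript.

For a field `k`, a closed immersion `ι : H → ℙⁿ_k = Proj k[x₀, …, xₙ]` and a quasi-coherent ideal sheaf
`𝔞 : H.IdealSheafData`, there are a degree `d ≥ 1` and finitely many forms `V_l ∈ k[x₀, …, xₙ]_d` such that on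
every standard chart `H_i = ι⁻¹ D₊(x_i)` the regular functions `ι^*(V_l / x_i^d)` lie in `𝔞(H_i)` and generate it
(`serreGen_exists_forms`; the version in the crux's spelling `(projectiveSpace n k).left`, `ι.app`,
`Proj.awayToSection` is `serreGen_exists_forms_projectiveSpace`).

Proof (elementary, no cohomology): `Γ(H_i, 𝒪_H)` is a quotient of `(k[x]_{(x_i)})₀ = k[x_l/x_i]`, hence
Noetherian, so `𝔞(H_i)` has finitely many generators `g = p / x_i^e` (`p` a form of degree `e`). On the affine
overlap `H_{ij} = ι⁻¹ D₊(x_i x_j)` one has `p/x_j^e = (x_i/x_j)^e · (p/x_i^e) ∈ 𝔞(H_{ij}) = 𝔞(H_j) · Γ(H_{ij})`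
(quasi-coherence, Mathlib `IdealSheafData.map_ideal`), and `Γ(H_{ij}) = Γ(H_j)[ (x_i/x_j)⁻¹ ]`, so
`(x_i/x_j)^N · p/x_j^e ∈ 𝔞(H_j)` for `N ≫ 0`. The forms are `V = x_i^{d-e} p` for a common large `d`: on `H_i`
they give back the generators, on `H_j` they give `(x_i/x_j)^{d-e} · p/x_j^e ∈ 𝔞(H_j)`.

Everything is proved; no named facts. Tree infrastructure used: `Motives.ProjFrac.{ZH, evalAway, evalAway_awayMap,
evalAway_surjective, ZH_mul_eq_basicOpen_evalAway}`, `Resolution.LinSec.{chart, coordSec, finiteType_chart}`;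
Mathlib `Scheme.IdealSheafData.map_ideal`, `IsAffineOpen.isLocalization_of_eq_basicOpen`,
`IsLocalization.algebraMap_mem_map_algebraMap_iff`, `HomogeneousLocalization.Away.mk`.

## References

* R. Hartshorne, *Algebraic Geometry*, GTM 52 (1977), II Cor. 5.10, II Thm. 5.14 (the idea; we prove the
  elementary chartwise form directly). [Hartshorne1977]
-/

noncomputable section

open CategoryTheory AlgebraicGeometry TopologicalSpace Opposite HomogeneousLocalization
open Literature.AlgebraicGeometry.Morphisms.ProjCech (grading PP)
open Literature.AlgebraicGeometry.Motives.ProjFrac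
open Literature.AlgebraicGeometry.Resolution.LinSec

attribute [local instance] MvPolynomial.gradedAlgebra
  Literature.AlgebraicGeometry.Motives.ProjBaseChange.algebraBase

universe u

set_option linter.dupNamespace false -- mandated namespace `Summit.<Summit>.<Problem>` of this single-conjunct summit

namespace Summit.ResolutionOfSingularities.ResolutionOfSingularities.Cruxes.EquisingularLift.StrataSplit

variable {k : Type u} [Field k] {n : ℕ}

/-! ## Fraction identities in the chart rings `(k[x]_{(x_j)})₀` -/

/-- Degree bookkeeping: for a form `p` of degree `e`, `x_i^M p` is a form of degree `M + e`. [folklore] -/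
theorem serreGen_X_pow_mul_mem (i : Fin (n + 1)) {e : ℕ} (M : ℕ) {p : MvPolynomial (Fin (n + 1)) k}
    (hp : p ∈ grading k n (e • 1)) :
    MvPolynomial.X i ^ M * p ∈ grading k n ((M + e) • 1) := by
  rw [add_smul]
  exact SetLike.mul_mem_graded (SetLike.pow_mem_graded M (X_mem (k := k) i)) hp

/-- In `(k[x]_{(x_j)})₀`: `x_i^M p / x_j^{M+e} = (x_i/x_j)^M · (p / x_j^e)`, the left-hand side written as the
fraction `V^1 / x_j^d` (`Away.isLocalizationElem`) of the degree-`d = M + e` form `V = x_i^M p`. [folklore] -/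
theorem serreGen_isLocalizationElem_X_pow_mul (i j : Fin (n + 1)) {e M d : ℕ} (h : M + e = d)
    {p : MvPolynomial (Fin (n + 1)) k} (hp : p ∈ grading k n (e • 1))
    (hV : MvPolynomial.X i ^ M * p ∈ grading k n d) :
    Away.isLocalizationElem (X_mem j) hV =
      Away.isLocalizationElem (X_mem j) (X_mem (k := k) i) ^ M *
        Away.mk (grading k n) (X_mem j) e p hp := by
  subst h
  apply HomogeneousLocalization.val_injective
  simp only [HomogeneousLocalization.val_mul, HomogeneousLocalization.val_pow, Away.val_mk,
    Localization.mk_pow, Localization.mk_mul]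
  rw [Localization.mk_eq_mk_iff, Localization.r_iff_exists]
  refine ⟨1, ?_⟩
  simp only [OneMemClass.coe_one, one_mul, Submonoid.coe_mul, SubmonoidClass.coe_pow]
  ring

variable {H : Scheme.{u}} (ι : H ⟶ PP k n)

/-! ## The transition rule for `p / x_i^e` on the overlap `H_{ij} = ι⁻¹ D₊(x_j x_i)` -/

/-- **Transition rule** on `ι⁻¹ D₊(x_j x_i)`: `p / x_j^e = (p / x_i^e) · (x_i / x_j)^e` for a form `p` of degree
`e`. [folklore] -/
theorem serreGen_res_evalAway_eq_mul_pow (i j : Fin (n + 1)) {e : ℕ} {p : MvPolynomial (Fin (n + 1)) k}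
    (hp : p ∈ grading k n (e • 1)) :
    H.presheaf.map (homOfLE (ZH_mono ι ⟨MvPolynomial.X i, rfl⟩ :
        ZH ι (MvPolynomial.X j * MvPolynomial.X i) ≤ chart ι j)).op
        (evalAway ι (MvPolynomial.X j) (Away.mk (grading k n) (X_mem j) e p hp)) =
      H.presheaf.map (homOfLE (ZH_mono ι ⟨MvPolynomial.X j,
          mul_comm (MvPolynomial.X j) (MvPolynomial.X i)⟩ :
          ZH ι (MvPolynomial.X j * MvPolynomial.X i) ≤ chart ι i)).op
          (evalAway ι (MvPolynomial.X i) (Away.mk (grading k n) (X_mem i) e p hp)) *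
        H.presheaf.map (homOfLE (ZH_mono ι ⟨MvPolynomial.X i, rfl⟩ :
          ZH ι (MvPolynomial.X j * MvPolynomial.X i) ≤ chart ι j)).op (coordSec ι j i) ^ e := by
  rw [coordSec, ← evalAway_awayMap ι (X_mem i) rfl, ← evalAway_awayMap ι (X_mem i) rfl,
    ← evalAway_awayMap ι (X_mem j) (mul_comm (MvPolynomial.X j) (MvPolynomial.X i)),
    ← map_pow, ← map_mul]
  congr 1
  apply HomogeneousLocalization.val_injective
  simp only [HomogeneousLocalization.val_mul, HomogeneousLocalization.val_pow, awayMap_mk, Away.val_mk,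
    Localization.mk_pow, Localization.mk_mul]
  rw [Localization.mk_eq_mk_iff, Localization.r_iff_exists]
  refine ⟨1, ?_⟩
  simp only [OneMemClass.coe_one, one_mul, Submonoid.coe_mul, SubmonoidClass.coe_pow]
  ring

/-! ## Clearing denominators across charts -/

/-- **Cross-chart membership.** If `p / x_i^e ∈ 𝔞(H_i)`, then `(x_i/x_j)^N · (p / x_j^e) ∈ 𝔞(H_j)` for some
`N`: restrict to the affine overlap `H_{ij}`, where `𝔞(H_{ij}) = 𝔞(H_i)·Γ(H_{ij}) = 𝔞(H_j)·Γ(H_{ij})`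
(quasi-coherence) and `Γ(H_{ij}) = Γ(H_j)[(x_i/x_j)⁻¹]`. [folklore] -/
theorem serreGen_exists_pow_mul_mem [IsClosedImmersion ι] (𝔞 : H.IdealSheafData) (i j : Fin (n + 1))
    {e : ℕ} {p : MvPolynomial (Fin (n + 1)) k} (hp : p ∈ grading k n (e • 1))
    (hmem : evalAway ι (MvPolynomial.X i) (Away.mk (grading k n) (X_mem i) e p hp) ∈
      𝔞.ideal ⟨chart ι i, isAffineOpen_chart ι i⟩) :
    ∃ N : ℕ, coordSec ι j i ^ N * evalAway ι (MvPolynomial.X j) (Away.mk (grading k n) (X_mem j) e p hp) ∈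
      𝔞.ideal ⟨chart ι j, isAffineOpen_chart ι j⟩ := by
  have hW : IsAffineOpen (ZH ι (MvPolynomial.X j * MvPolynomial.X i)) :=
    isAffineOpen_ZH ι (SetLike.mul_mem_graded (X_mem j) (X_mem i)) two_pos
  have hWj : ZH ι (MvPolynomial.X j * MvPolynomial.X i) ≤ chart ι j := ZH_mono ι ⟨MvPolynomial.X i, rfl⟩
  have hWi : ZH ι (MvPolynomial.X j * MvPolynomial.X i) ≤ chart ι i :=
    ZH_mono ι ⟨MvPolynomial.X j, mul_comm (MvPolynomial.X j) (MvPolynomial.X i)⟩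
  -- (1) the restriction of `p / x_i^e` to the overlap lies in `𝔞(H_{ij}) = 𝔞(H_i) Γ(H_{ij})`
  have h1 : H.presheaf.map (homOfLE hWi).op
      (evalAway ι (MvPolynomial.X i) (Away.mk (grading k n) (X_mem i) e p hp)) ∈
        𝔞.ideal ⟨ZH ι (MvPolynomial.X j * MvPolynomial.X i), hW⟩ := by
    rw [← 𝔞.map_ideal (U := ⟨ZH ι (MvPolynomial.X j * MvPolynomial.X i), hW⟩)
      (V := ⟨chart ι i, isAffineOpen_chart ι i⟩) hWi]
    exact Ideal.mem_map_of_mem _ hmem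
  -- (2) hence so does the restriction of `p / x_j^e = (p / x_i^e) (x_i/x_j)^e`
  have h2 : H.presheaf.map (homOfLE hWj).op
      (evalAway ι (MvPolynomial.X j) (Away.mk (grading k n) (X_mem j) e p hp)) ∈
        𝔞.ideal ⟨ZH ι (MvPolynomial.X j * MvPolynomial.X i), hW⟩ := by
    rw [serreGen_res_evalAway_eq_mul_pow ι i j hp]
    exact Ideal.mul_mem_right _ _ h1
  -- (3) `𝔞(H_{ij}) = 𝔞(H_j) Γ(H_{ij})`, and `Γ(H_{ij})` is the localization of `Γ(H_j)` at `x_i/x_j`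
  rw [← 𝔞.map_ideal (U := ⟨ZH ι (MvPolynomial.X j * MvPolynomial.X i), hW⟩)
    (V := ⟨chart ι j, isAffineOpen_chart ι j⟩) hWj] at h2
  letI := (H.presheaf.map (homOfLE hWj).op).hom.toAlgebra
  haveI : IsLocalization.Away (coordSec ι j i) Γ(H, ZH ι (MvPolynomial.X j * MvPolynomial.X i)) :=
    (isAffineOpen_chart ι j).isLocalization_of_eq_basicOpen (coordSec ι j i) (homOfLE hWj)
      (ZH_mul_eq_basicOpen_evalAway ι (X_mem j) one_pos (X_mem i) one_pos)
  obtain ⟨s, ⟨N, rfl⟩, hs⟩ :=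
    (IsLocalization.algebraMap_mem_map_algebraMap_iff (Submonoid.powers (coordSec ι j i))
      Γ(H, ZH ι (MvPolynomial.X j * MvPolynomial.X i)) _ _).mp h2
  exact ⟨N, hs⟩

/-! ## Finiteness on the charts -/

/-- Every ideal of `Γ(H_i, 𝒪_H)` is finitely generated: the chart ring is of finite type over the field `k`
(`LinSec.finiteType_chart`), hence Noetherian. [folklore] -/
theorem serreGen_ideal_fg [IsClosedImmersion ι] (i : Fin (n + 1)) (I : Ideal Γ(H, chart ι i)) : I.FG := by
  letI := Literature.AlgebraicGeometry.Resolution.LinSec.chartAlgebra ι i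
  haveI := finiteType_chart ι i
  haveI : IsNoetherianRing Γ(H, chart ι i) := Algebra.FiniteType.isNoetherianRing k _
  exact IsNoetherian.noetherian I

/-- Generators of `𝔞(H_i)` written as fractions `p_t / x_i^{e_t}` with `p_t` a form of degree `e_t`. [folklore] -/
theorem serreGen_exists_generators [IsClosedImmersion ι] (𝔞 : H.IdealSheafData) (i : Fin (n + 1)) :
    ∃ (m : ℕ) (e : Fin m → ℕ) (p : Fin m → MvPolynomial (Fin (n + 1)) k)
      (hp : ∀ t, p t ∈ grading k n (e t • 1)),
      Ideal.span (Set.range fun t =>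
          evalAway ι (MvPolynomial.X i) (Away.mk (grading k n) (X_mem i) (e t) (p t) (hp t))) =
        𝔞.ideal ⟨chart ι i, isAffineOpen_chart ι i⟩ := by
  obtain ⟨m, g, hg⟩ := Submodule.fg_iff_exists_fin_generating_family.mp
    (serreGen_ideal_fg ι i (𝔞.ideal ⟨chart ι i, isAffineOpen_chart ι i⟩))
  have hsurj : ∀ t, ∃ (e : ℕ) (p : MvPolynomial (Fin (n + 1)) k) (hp : p ∈ grading k n (e • 1)),
      evalAway ι (MvPolynomial.X i) (Away.mk (grading k n) (X_mem i) e p hp) = g t := by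
    intro t
    obtain ⟨z, hz⟩ := evalAway_surjective ι (X_mem i) one_pos (g t)
    obtain ⟨e, p, hp, rfl⟩ := Away.mk_surjective (grading k n) (X_mem i) z
    exact ⟨e, p, hp, hz⟩
  choose e p hp he using hsurj
  refine ⟨m, e, p, hp, ?_⟩
  have : (fun t => evalAway ι (MvPolynomial.X i) (Away.mk (grading k n) (X_mem i) (e t) (p t) (hp t))) = g :=
    funext he
  rw [this]
  exact hg

/-! ## The theorem -/

/-- **Serre generators (chartwise, elementary form).** For a closed immersion `ι : H → ℙⁿ_k` over a field and an
ideal sheaf `𝔞` on `H` there are `d ≥ 1`, `m ≥ 1` and forms `V_1, …, V_m ∈ k[x₀, …, xₙ]_d` such that on every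
standard chart `H_i = ι⁻¹ D₊(x_i)` the ideal `𝔞(H_i) ⊆ Γ(H_i, 𝒪_H)` is generated by the functions
`ι^*(V_l / x_i^d)`. [folklore] -/
theorem serreGen_exists_forms [IsClosedImmersion ι] (𝔞 : H.IdealSheafData) :
    ∃ (d m : ℕ) (V : Fin m → ↥(grading k n d)), 0 < d ∧ 0 < m ∧
      ∀ (i : Fin (n + 1)) (hU : IsAffineOpen (chart ι i)),
        𝔞.ideal ⟨chart ι i, hU⟩ = Ideal.span (Set.range fun l =>
          evalAway ι (MvPolynomial.X i) (Away.isLocalizationElem (X_mem i) (V l).2)) := by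
  classical
  -- generators on every chart
  choose m e p hp hspan using serreGen_exists_generators ι 𝔞
  -- cross-chart exponents
  have hcross : ∀ (i j : Fin (n + 1)) (t : Fin (m i)), ∃ N : ℕ,
      coordSec ι j i ^ N * evalAway ι (MvPolynomial.X j)
        (Away.mk (grading k n) (X_mem j) (e i t) (p i t) (hp i t)) ∈
          𝔞.ideal ⟨chart ι j, isAffineOpen_chart ι j⟩ := by
    intro i j t
    apply serreGen_exists_pow_mul_mem ι 𝔞 i j (hp i t)
    rw [← hspan i]
    exact Ideal.subset_span ⟨t, rfl⟩
  choose N hN using hcross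
  -- a common degree `d` with `e ≤ d` and `N + e ≤ d` everywhere
  obtain ⟨d, hd, hNd⟩ : ∃ d : ℕ, 0 < d ∧ ∀ i j t, N i j t + e i t ≤ d := by
    let E : ℕ := Finset.univ.sup fun c : (Σ i, Fin (m i)) => e c.1 c.2
    let Nm : ℕ := Finset.univ.sup fun c : (Σ i, Fin (m i)) × Fin (n + 1) => N c.1.1 c.2 c.1.2
    refine ⟨E + Nm + 1, by omega, fun i j t => ?_⟩
    have h1 : e i t ≤ E :=
      Finset.le_sup (f := fun c : (Σ i, Fin (m i)) => e c.1 c.2) (Finset.mem_univ ⟨i, t⟩)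
    have h2 : N i j t ≤ Nm :=
      Finset.le_sup (f := fun c : (Σ i, Fin (m i)) × Fin (n + 1) => N c.1.1 c.2 c.1.2)
        (Finset.mem_univ (⟨i, t⟩, j))
    omega
  have hed : ∀ i t, d - e i t + e i t = d := fun i t => Nat.sub_add_cancel (by
    have := hNd i i t; omega)
  -- the forms, indexed by `Option (Σ i, Fin (m i))` (`none ↦ 0`, so that `m ≥ 1`)
  let σ := Option (Σ i, Fin (m i))
  have hVmem : ∀ c : Σ i, Fin (m i),
      MvPolynomial.X c.1 ^ (d - e c.1 c.2) * p c.1 c.2 ∈ grading k n d := fun c => by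
    have h := serreGen_X_pow_mul_mem c.1 (d - e c.1 c.2) (hp c.1 c.2)
    rwa [hed, smul_eq_mul, mul_one] at h
  let V : σ → ↥(grading k n d) := fun c =>
    match c with
    | none => ⟨0, Submodule.zero_mem _⟩
    | some c => ⟨MvPolynomial.X c.1 ^ (d - e c.1 c.2) * p c.1 c.2, hVmem c⟩
  -- the key computation on chart `j`: `V_c / x_j^d = (x_i/x_j)^{d-e} · (p / x_j^e)` for `c = (i, t)`
  have key : ∀ (j : Fin (n + 1)) (c : Σ i, Fin (m i)),
      evalAway ι (MvPolynomial.X j) (Away.isLocalizationElem (X_mem j) (V (some c)).2) =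
        coordSec ι j c.1 ^ (d - e c.1 c.2) *
          evalAway ι (MvPolynomial.X j) (Away.mk (grading k n) (X_mem j) (e c.1 c.2) (p c.1 c.2) (hp c.1 c.2)) := by
    intro j c
    rw [coordSec, ← map_pow, ← map_mul]
    exact congrArg (evalAway ι (MvPolynomial.X j))
      (serreGen_isLocalizationElem_X_pow_mul c.1 j (hed c.1 c.2) (hp c.1 c.2) (hVmem c))
  have key0 : ∀ j : Fin (n + 1),
      evalAway ι (MvPolynomial.X j) (Away.isLocalizationElem (X_mem j) (V none).2) = 0 := by
    intro j
    rw [← map_zero (evalAway ι (MvPolynomial.X j))]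
    congr 1
    apply HomogeneousLocalization.val_injective
    simp only [Away.val_mk, HomogeneousLocalization.val_zero]
    simp [V, Localization.mk_zero]
  refine ⟨d, Fintype.card σ, V ∘ (Fintype.equivFin σ).symm, hd, Fintype.card_pos, fun j hU => ?_⟩
  have hUeq : hU = isAffineOpen_chart ι j := rfl
  subst hUeq
  apply le_antisymm
  · -- `𝔞(H_j)` is generated by the `p_t / x_j^{e_t} = V_{(j,t)} / x_j^d`
    rw [← hspan j, Ideal.span_le]
    rintro _ ⟨t, rfl⟩
    have ht : evalAway ι (MvPolynomial.X j)
        (Away.mk (grading k n) (X_mem j) (e j t) (p j t) (hp j t)) =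
          evalAway ι (MvPolynomial.X j) (Away.isLocalizationElem (X_mem j) (V (some ⟨j, t⟩)).2) := by
      rw [key, coordSec_self, one_pow, one_mul]
    simp only [SetLike.mem_coe]
    rw [ht]
    exact Ideal.subset_span ⟨Fintype.equivFin σ (some ⟨j, t⟩), by simp⟩
  · -- every `V_c / x_j^d` lies in `𝔞(H_j)`
    have hall : ∀ c : σ, evalAway ι (MvPolynomial.X j) (Away.isLocalizationElem (X_mem j) (V c).2) ∈
        𝔞.ideal ⟨chart ι j, isAffineOpen_chart ι j⟩ := by
      rintro (_ | c)
      · rw [key0]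
        exact Ideal.zero_mem _
      · rw [key]
        obtain ⟨M', hM'⟩ := Nat.exists_eq_add_of_le
          (show N c.1 j c.2 ≤ d - e c.1 c.2 by have := hNd c.1 j c.2; omega)
        rw [hM', pow_add, mul_comm (coordSec ι j c.1 ^ N c.1 j c.2), mul_assoc]
        exact Ideal.mul_mem_left _ _ (hN c.1 j c.2)
    rw [Ideal.span_le]
    rintro _ ⟨l, rfl⟩
    exact hall _

/-! ## The crux's spelling -/

/-- **Serre generators, in the spelling of the crux `EquisingularLift`** (`ℙⁿ_k` as
`(Motives.projectiveSpace n k).left = Proj k[x₀, …, xₙ]`, the functions `V_l / x_i^d` as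
`ι.app D₊(x_i) (Proj.awayToSection _ (x_i) (V_l^1 / x_i^d))`): for a closed immersion `ι : H → ℙⁿ_k` and an
ideal sheaf `𝔞` on `H` there are `d ≥ 1`, `m ≥ 1` and degree-`d` forms `V_1, …, V_m` with
`𝔞(ι⁻¹ D₊(x_i)) = (ι^*(V_l / x_i^d) : l)` for every `i`. The charts `ι⁻¹ D₊(x_i)` are affine
(`LinSec.isAffineOpen_chart`) and cover `H` (`LinSec.iSup_chart`). [folklore] -/
theorem serreGen_exists_forms_projectiveSpace (n : ℕ) (k : Type u) [Field k] (H : Scheme.{u})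
    (ι : H ⟶ (Literature.AlgebraicGeometry.Motives.projectiveSpace n k).left) (hι : IsClosedImmersion ι)
    (𝔞 : H.IdealSheafData) :
    ∃ (d m : ℕ) (V : Fin m → ↥(MvPolynomial.homogeneousSubmodule (Fin (n + 1)) k d)), 0 < d ∧ 0 < m ∧
      ∀ (i : Fin (n + 1))
        (hU : IsAffineOpen
          (ι ⁻¹ᵁ Proj.basicOpen (MvPolynomial.homogeneousSubmodule (Fin (n + 1)) k) (MvPolynomial.X i))),
        𝔞.ideal ⟨ι ⁻¹ᵁ Proj.basicOpen (MvPolynomial.homogeneousSubmodule (Fin (n + 1)) k) (MvPolynomial.X i),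
            hU⟩ =
          Ideal.span (Set.range fun l =>
            ι.app (Proj.basicOpen (MvPolynomial.homogeneousSubmodule (Fin (n + 1)) k) (MvPolynomial.X i))
              (Proj.awayToSection (MvPolynomial.homogeneousSubmodule (Fin (n + 1)) k) (MvPolynomial.X i)
                (Away.isLocalizationElem (X_mem (k := k) i) (V l).2))) := by
  haveI : @IsClosedImmersion H (PP k n) ι := hι
  exact serreGen_exists_forms (k := k) (n := n) ι 𝔞

end Summit.ResolutionOfSingularities.ResolutionOfSingularities.Cruxes.EquisingularLift.StrataSplit

end
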